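import Literature.Analysis.FluidPDE.KwonDriftTimeDerivativeWeak
import HarnessLib

/-!
# Kwon's drift mollified in time is jointly smooth ((O1)/(O3) of the local energy step)

Analysis/FluidPDE proof file (theorems only) on the discharge path of the named fact
`Literature.Analysis.FluidPDE.kwon2023_velocity_epsilon_regularity`
(`PressureFreeEpsilonRegularity.lean`; H. Kwon, J. Differential Equations (2023) =
arXiv:2104.03160, Thm. 1.4). In the proof of Lemma 2.5 (p. 8–9) the drift `h = H u` of the
decomposition `u = v + h` (Remark 2.3) is smooth in `x` (harmonic in `B₁`) but only as regular in
`t` as `u`; the local energy inequality for `v = u − h` is derived through a time-mollified drift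
`h_α = ρ_α ⋆_t h` (design memo `kits/A4-R1b-localEnergy-design-ser-a-g8.md`, (O1)). This file
proves that `h_α` is JOINTLY SMOOTH on `ℝ × ℝ³`:

* `Kwon2023.driftField_eq_integral_sub` — the slice `h(σ,x) = ∫ (u·∇φ)(y) ∇k(x−y) dy −
  ∫ ∇k(x−y) × (∇φ × u)(y) dy`;
* `Kwon2023.timeConv_driftField_eq_convolution_sub` — the time mollification of the drift is a
  difference of two SPACE–TIME convolutions of the locally integrable densities
  `(s,y) ↦ (W·∇φ)(s,y)`, `(s,y) ↦ (∇φ × W)(s,y)` with the smooth compactly supported kernel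
  `κ(τ,ξ) = ρ(τ) ∇k(ξ)`;
* `Kwon2023.contDiff_timeConv_driftField` — hence `(t,x) ↦ h_α(t,x) = (ρ ⋆_t h(·,x))(t)` is `C^∞`
  on `ℝ × ℝ³` (Mathlib's `HasCompactSupport.contDiff_convolution_right`).

No NS-regularity statement is touched.

## Mathlib / tree search

Tree (reused): `harmonicPart_eq_integral` (`KwonHarmonicPartKernel`), `driftField`,
`IsGoodVelocity` (`KwonSpaceTimeFields`, `KwonDecompositionMomentum`), `scalarDensity`,
`vectorDensity`, `annularKernel`, `kwonCutoff`, `exists_bound_gradient_kwonCutoff`,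
`exists_bound_gradient_annularKernel`, `continuous_uncurry_cross`, `crossCLM`,
`contDiff_gradient_of_contDiff_top`. Mathlib: `ContDiffBump.normed`,
`HasCompactSupport.contDiff_convolution_right`, `HasCompactSupport.convolutionExists_right`,
`convolution_def`, `convolution_eq_swap`, `integral_prod`, `Integrable.integral_prod_left`,
`LocallyIntegrable.mono`.

## References

* H. Kwon, *The role of the pressure in the regularity theory for the Navier–Stokes equations*,
  J. Differential Equations 357 (2023) = arXiv:2104.03160: Remark 2.3 (2.3)–(2.4) and Lemma 2.5
  (proof, p. 8–9). [Kwon2023RolePressure]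
-/

noncomputable section

open MeasureTheory Set Function Filter Topology TopologicalSpace Metric InnerProductSpace
  ContinuousLinearMap
open scoped NNReal ENNReal RealInnerProductSpace Convolution ContDiff

namespace Literature.Analysis.FluidPDE

namespace Kwon2023

variable {W : ℝ → EuclideanSpace ℝ (Fin 3) → EuclideanSpace ℝ (Fin 3)}

/-! ### The slice as a difference of two kernel integrals -/

/-- The scalar-density piece of the kernel integrand is integrable. [folklore] -/
private theorem integrable_sd_smul {w : EuclideanSpace ℝ (Fin 3) → EuclideanSpace ℝ (Fin 3)}
    (hw : IntegrableOn w (ball (0 : EuclideanSpace ℝ (Fin 3)) 2)) (x : EuclideanSpace ℝ (Fin 3)) :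
    Integrable fun y => scalarDensity w y • gradient annularKernel (x - y) := by
  obtain ⟨K, -, hK⟩ := exists_bound_gradient_annularKernel
  have hs := integrable_scalarDensity hw
  have hgk : Continuous (gradient annularKernel) :=
    FluidPDE.continuous_gradient_of_contDiff (contDiff_annularKernel (n := 1))
  refine (hs.norm.mul_const K).mono'
    (hs.aestronglyMeasurable.smul (hgk.comp (continuous_const.sub continuous_id)).aestronglyMeasurable)
    (Eventually.of_forall fun y => ?_)
  rw [norm_smul]
  exact mul_le_mul_of_nonneg_left (hK _) (norm_nonneg _)

/-- The vector-density piece of the kernel integrand is integrable. [folklore] -/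
private theorem integrable_cross_vd {w : EuclideanSpace ℝ (Fin 3) → EuclideanSpace ℝ (Fin 3)}
    (hw : IntegrableOn w (ball (0 : EuclideanSpace ℝ (Fin 3)) 2)) (x : EuclideanSpace ℝ (Fin 3)) :
    Integrable fun y => cross (gradient annularKernel (x - y)) (vectorDensity w y) := by
  obtain ⟨K, -, hK⟩ := exists_bound_gradient_annularKernel
  have hv := integrable_vectorDensity hw
  have hgk : Continuous (gradient annularKernel) :=
    FluidPDE.continuous_gradient_of_contDiff (contDiff_annularKernel (n := 1))
  have hm : AEStronglyMeasurable (fun y => cross (gradient annularKernel (x - y)) (vectorDensity w y)) volume :=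
    continuous_uncurry_cross.comp_aestronglyMeasurable₂
      ((hgk.comp (continuous_const.sub continuous_id)).aestronglyMeasurable) hv.aestronglyMeasurable
  refine ((hv.norm.const_mul (‖crossCLM‖ * K))).mono' hm (Eventually.of_forall fun y => ?_)
  rw [← crossCLM_apply]
  calc ‖crossCLM (gradient annularKernel (x - y)) (vectorDensity w y)‖
      ≤ ‖crossCLM‖ * ‖gradient annularKernel (x - y)‖ * ‖vectorDensity w y‖ := le_opNorm₂ _ _ _
    _ ≤ ‖crossCLM‖ * K * ‖vectorDensity w y‖ := by
        gcongr
        exact hK _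

/-- **The drift slice as a difference of two kernel integrals**:
`h(σ,x) = ∫ (W(σ)·∇φ)(y) ∇k(x−y) dy − ∫ ∇k(x−y) × (∇φ × W(σ))(y) dy`.
[cite: Kwon2023RolePressure, Remark 2.3 (2.3)] -/
theorem driftField_eq_integral_sub (hW : IsGoodVelocity W) (σ : ℝ) (x : EuclideanSpace ℝ (Fin 3)) :
    driftField W σ x = (∫ y, scalarDensity (W σ) y • gradient annularKernel (x - y)) -
      ∫ y, cross (gradient annularKernel (x - y)) (vectorDensity (W σ) y) := by
  have hw : IntegrableOn (W σ) (ball (0 : EuclideanSpace ℝ (Fin 3)) 2) := (hW.integrable σ).integrableOn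
  rw [driftField, harmonicPart_eq_integral hw x, integral_sub (integrable_sd_smul hw x) (integrable_cross_vd hw x)]

/-! ### The space–time densities and the kernel -/

/-- The space–time scalar density `(s,y) ↦ (W·∇φ)(s,y)` of a good velocity is locally integrable
(`|W·∇φ| ≤ ‖∇φ‖_∞ |W|`, `W ∈ L³(Q₂)`). [cite: Kwon2023RolePressure, Lemma 2.5 (proof, p. 8) with Def. 1.1 and Remark 2.3] -/
theorem locallyIntegrable_scalarDensity_uncurry (hW : IsGoodVelocity W) :
    LocallyIntegrable (fun q : ℝ × EuclideanSpace ℝ (Fin 3) => scalarDensity (W q.1) q.2) volume := by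
  obtain ⟨C, hC0, hC⟩ := exists_bound_gradient_kwonCutoff
  have hm : AEStronglyMeasurable (fun q : ℝ × EuclideanSpace ℝ (Fin 3) => scalarDensity (W q.1) q.2) volume :=
    hW.stronglyMeasurable.aestronglyMeasurable.inner
      (continuous_gradient_kwonCutoff.comp continuous_snd).aestronglyMeasurable
  refine (hW.locallyIntegrable.smul C).mono hm (Eventually.of_forall fun q => ?_)
  rw [Pi.smul_apply, norm_smul, Real.norm_of_nonneg hC0, mul_comm]
  exact (norm_inner_le_norm _ _).trans (mul_le_mul_of_nonneg_left (hC _) (norm_nonneg _))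

/-- The space–time vector density `(s,y) ↦ (∇φ × W)(s,y)` of a good velocity is locally integrable
(`|∇φ × W| ≲ ‖∇φ‖_∞ |W|`, `W ∈ L³(Q₂)`). [cite: Kwon2023RolePressure, Lemma 2.5 (proof, p. 8) with Def. 1.1 and Remark 2.3] -/
theorem locallyIntegrable_vectorDensity_uncurry (hW : IsGoodVelocity W) :
    LocallyIntegrable (fun q : ℝ × EuclideanSpace ℝ (Fin 3) => vectorDensity (W q.1) q.2) volume := by
  obtain ⟨C, hC0, hC⟩ := exists_bound_gradient_kwonCutoff
  have hm : AEStronglyMeasurable (fun q : ℝ × EuclideanSpace ℝ (Fin 3) => vectorDensity (W q.1) q.2) volume :=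
    continuous_uncurry_cross.comp_aestronglyMeasurable₂
      (continuous_gradient_kwonCutoff.comp continuous_snd).aestronglyMeasurable
      hW.stronglyMeasurable.aestronglyMeasurable
  refine (hW.locallyIntegrable.smul (‖crossCLM‖ * C)).mono hm (Eventually.of_forall fun q => ?_)
  rw [Pi.smul_apply, norm_smul, Real.norm_of_nonneg (mul_nonneg (norm_nonneg crossCLM) hC0)]
  change ‖cross (gradient kwonCutoff q.2) (W q.1 q.2)‖ ≤ ‖crossCLM‖ * C * ‖uncurry W q‖
  rw [← crossCLM_apply]
  calc ‖crossCLM (gradient kwonCutoff q.2) (W q.1 q.2)‖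
      ≤ ‖crossCLM‖ * ‖gradient kwonCutoff q.2‖ * ‖W q.1 q.2‖ := le_opNorm₂ _ _ _
    _ ≤ ‖crossCLM‖ * C * ‖uncurry W q‖ := by
        rw [uncurry_apply_pair] ; gcongr; exact hC _

/-- The space–time kernel `κ(τ,ξ) = ρ(τ) ∇k(ξ)` is smooth. [folklore] -/
private theorem contDiff_bumpKernel (φ : ContDiffBump (0 : ℝ)) :
    ContDiff ℝ ∞ fun q : ℝ × EuclideanSpace ℝ (Fin 3) => φ.normed volume q.1 • gradient annularKernel q.2 :=
  (φ.contDiff_normed.comp contDiff_fst).smul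
    ((contDiff_gradient_of_contDiff_top contDiff_annularKernel).comp contDiff_snd)

/-- The space–time kernel `κ(τ,ξ) = ρ(τ) ∇k(ξ)` has compact support. [folklore] -/
private theorem hasCompactSupport_bumpKernel (φ : ContDiffBump (0 : ℝ)) :
    HasCompactSupport fun q : ℝ × EuclideanSpace ℝ (Fin 3) => φ.normed volume q.1 • gradient annularKernel q.2 := by
  have hk : HasCompactSupport (gradient annularKernel) := by
    have e : gradient annularKernel = (InnerProductSpace.toDual ℝ (EuclideanSpace ℝ (Fin 3))).symm ∘
        fderiv ℝ annularKernel := by funext w; rfl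
    rw [e]
    exact hasCompactSupport_annularKernel.fderiv (𝕜 := ℝ) |>.comp_left (map_zero _)
  refine HasCompactSupport.intro ((φ.hasCompactSupport_normed (μ := volume)).prod hk) ?_
  rintro ⟨τ, ξ⟩ hq
  rcases not_and_or.1 (fun h => hq (mem_prod.2 h)) with h | h
  · simp [image_eq_zero_of_notMem_tsupport h]
  · simp [image_eq_zero_of_notMem_tsupport h]

/-! ### The time-mollified drift as a difference of space–time convolutions -/

/-- **The time-mollified drift is a difference of two space–time convolutions**: for a bump `ρ`,
`(ρ ⋆_t h(·,x))(t) = ((W·∇φ) ⋆ κ)(t,x) − ((∇φ × W) ⋆_× κ)(t,x)` with `κ(τ,ξ) = ρ(τ)∇k(ξ)` (the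
second convolution taken with the bilinear map `(a, b) ↦ b × a`).
[cite: Kwon2023RolePressure, Remark 2.3 (2.3)–(2.4) with Lemma 2.5 (proof, p. 8–9)] -/
theorem timeConv_driftField_eq_convolution_sub (hW : IsGoodVelocity W) (φ : ContDiffBump (0 : ℝ))
    (t : ℝ) (x : EuclideanSpace ℝ (Fin 3)) :
    (φ.normed volume ⋆[lsmul ℝ ℝ, volume] fun σ => driftField W σ x) t =
      ((fun q : ℝ × EuclideanSpace ℝ (Fin 3) => scalarDensity (W q.1) q.2) ⋆[
          (lsmul ℝ ℝ : ℝ →L[ℝ] EuclideanSpace ℝ (Fin 3) →L[ℝ] EuclideanSpace ℝ (Fin 3)), volume]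
        (fun q : ℝ × EuclideanSpace ℝ (Fin 3) => φ.normed volume q.1 • gradient annularKernel q.2)) (t, x) -
      ((fun q : ℝ × EuclideanSpace ℝ (Fin 3) => vectorDensity (W q.1) q.2) ⋆[crossCLM.flip, volume]
        (fun q : ℝ × EuclideanSpace ℝ (Fin 3) => φ.normed volume q.1 • gradient annularKernel q.2)) (t, x) := by
  set ρ : ℝ → ℝ := φ.normed volume with hρ
  set κ : ℝ × EuclideanSpace ℝ (Fin 3) → EuclideanSpace ℝ (Fin 3) := fun q =>
    ρ q.1 • gradient annularKernel q.2 with hκdef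
  have hκ : Continuous κ := (contDiff_bumpKernel φ).continuous
  have hκc : HasCompactSupport κ := hasCompactSupport_bumpKernel φ
  have hSD := locallyIntegrable_scalarDensity_uncurry hW
  have hVD := locallyIntegrable_vectorDensity_uncurry hW
  -- the two space–time integrands and their Fubini splittings
  have hG₁ : Integrable (fun q : ℝ × EuclideanSpace ℝ (Fin 3) =>
      scalarDensity (W q.1) q.2 • (ρ (t - q.1) • gradient annularKernel (x - q.2))) := by
    have h := hκc.convolutionExists_right
      (lsmul ℝ ℝ : ℝ →L[ℝ] EuclideanSpace ℝ (Fin 3) →L[ℝ] EuclideanSpace ℝ (Fin 3)) hSD hκ (t, x)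
    refine h.congr (Eventually.of_forall fun q => ?_)
    simp only [lsmul_apply, hκdef, Prod.fst_sub, Prod.snd_sub]
  have hG₂ : Integrable (fun q : ℝ × EuclideanSpace ℝ (Fin 3) =>
      cross (ρ (t - q.1) • gradient annularKernel (x - q.2)) (vectorDensity (W q.1) q.2)) := by
    have h := hκc.convolutionExists_right crossCLM.flip hVD hκ (t, x)
    refine h.congr (Eventually.of_forall fun q => ?_)
    simp only [flip_apply, crossCLM_apply, hκdef, Prod.fst_sub, Prod.snd_sub]
  have e₁ : ∀ s, ∫ y, scalarDensity (W s) y • (ρ (t - s) • gradient annularKernel (x - y)) =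
      ρ (t - s) • ∫ y, scalarDensity (W s) y • gradient annularKernel (x - y) := by
    intro s
    rw [← integral_smul]
    refine integral_congr_ae (Eventually.of_forall fun y => ?_)
    exact smul_comm _ _ _
  have e₂ : ∀ s, ∫ y, cross (ρ (t - s) • gradient annularKernel (x - y)) (vectorDensity (W s) y) =
      ρ (t - s) • ∫ y, cross (gradient annularKernel (x - y)) (vectorDensity (W s) y) := by
    intro s
    rw [← integral_smul]
    refine integral_congr_ae (Eventually.of_forall fun y => ?_)
    dsimp only
    rw [← crossCLM_apply, ← crossCLM_apply, map_smul, smul_apply]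
  -- the right-hand side
  have R₁ : ((fun q : ℝ × EuclideanSpace ℝ (Fin 3) => scalarDensity (W q.1) q.2) ⋆[
      (lsmul ℝ ℝ : ℝ →L[ℝ] EuclideanSpace ℝ (Fin 3) →L[ℝ] EuclideanSpace ℝ (Fin 3)), volume] κ) (t, x) =
      ∫ s, ρ (t - s) • ∫ y, scalarDensity (W s) y • gradient annularKernel (x - y) := by
    rw [convolution_def]
    have e : (fun q : ℝ × EuclideanSpace ℝ (Fin 3) =>
        (lsmul ℝ ℝ : ℝ →L[ℝ] EuclideanSpace ℝ (Fin 3) →L[ℝ] EuclideanSpace ℝ (Fin 3))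
          (scalarDensity (W q.1) q.2) (κ ((t, x) - q))) = fun q =>
        scalarDensity (W q.1) q.2 • (ρ (t - q.1) • gradient annularKernel (x - q.2)) := by
      funext q; simp only [lsmul_apply, hκdef, Prod.fst_sub, Prod.snd_sub]
    rw [e, show (volume : Measure (ℝ × EuclideanSpace ℝ (Fin 3))) = (volume : Measure ℝ).prod volume from rfl,
      integral_prod _ hG₁]
    exact integral_congr_ae (Eventually.of_forall fun s => e₁ s)
  have R₂ : ((fun q : ℝ × EuclideanSpace ℝ (Fin 3) => vectorDensity (W q.1) q.2) ⋆[crossCLM.flip, volume] κ)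
      (t, x) = ∫ s, ρ (t - s) • ∫ y, cross (gradient annularKernel (x - y)) (vectorDensity (W s) y) := by
    rw [convolution_def]
    have e : (fun q : ℝ × EuclideanSpace ℝ (Fin 3) => crossCLM.flip (vectorDensity (W q.1) q.2) (κ ((t, x) - q))) =
        fun q => cross (ρ (t - q.1) • gradient annularKernel (x - q.2)) (vectorDensity (W q.1) q.2) := by
      funext q; simp only [flip_apply, crossCLM_apply, hκdef, Prod.fst_sub, Prod.snd_sub]
    rw [e, show (volume : Measure (ℝ × EuclideanSpace ℝ (Fin 3))) = (volume : Measure ℝ).prod volume from rfl,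
      integral_prod _ hG₂]
    exact integral_congr_ae (Eventually.of_forall fun s => e₂ s)
  -- integrability in time of the two mollified pieces
  have I₁ : Integrable fun s => ρ (t - s) • ∫ y, scalarDensity (W s) y • gradient annularKernel (x - y) := by
    refine (hG₁.integral_prod_left).congr (Eventually.of_forall fun s => ?_)
    exact e₁ s
  have I₂ : Integrable fun s => ρ (t - s) • ∫ y, cross (gradient annularKernel (x - y)) (vectorDensity (W s) y) := by
    refine (hG₂.integral_prod_left).congr (Eventually.of_forall fun s => ?_)
    exact e₂ s
  -- the left-hand side
  rw [convolution_eq_swap, R₁, R₂, ← integral_sub I₁ I₂]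
  refine integral_congr_ae (Eventually.of_forall fun s => ?_)
  simp only [lsmul_apply]
  rw [driftField_eq_integral_sub hW s x, smul_sub]

/-- **The time-mollified drift is jointly smooth**: for a good velocity `W` and a bump `ρ`, the
field `(t,x) ↦ h_ρ(t,x) = ∫ ρ(t−s) h(s,x) ds`, `h = driftField W`, is `C^∞` on `ℝ × ℝ³` (it is a
difference of space–time convolutions of locally integrable densities with the smooth compactly
supported kernel `ρ(τ)∇k(ξ)`). This is the smoothness of the mollified drift used in the proof of
the local energy inequality of Lemma 2.5. [cite: Kwon2023RolePressure, Lemma 2.5 (proof, p. 8–9) with Remark 2.3] -/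
theorem contDiff_timeConv_driftField (hW : IsGoodVelocity W) (φ : ContDiffBump (0 : ℝ)) :
    ContDiff ℝ ∞ fun z : ℝ × EuclideanSpace ℝ (Fin 3) =>
      (φ.normed volume ⋆[lsmul ℝ ℝ, volume] fun σ => driftField W σ z.2) z.1 := by
  have hκ := contDiff_bumpKernel φ
  have hκc := hasCompactSupport_bumpKernel φ
  have h₁ : ContDiff ℝ ∞ ((fun q : ℝ × EuclideanSpace ℝ (Fin 3) => scalarDensity (W q.1) q.2) ⋆[
      (lsmul ℝ ℝ : ℝ →L[ℝ] EuclideanSpace ℝ (Fin 3) →L[ℝ] EuclideanSpace ℝ (Fin 3)), volume]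
      (fun q : ℝ × EuclideanSpace ℝ (Fin 3) => φ.normed volume q.1 • gradient annularKernel q.2)) :=
    hκc.contDiff_convolution_right _ (locallyIntegrable_scalarDensity_uncurry hW) hκ
  have h₂ : ContDiff ℝ ∞ ((fun q : ℝ × EuclideanSpace ℝ (Fin 3) => vectorDensity (W q.1) q.2) ⋆[crossCLM.flip, volume]
      (fun q : ℝ × EuclideanSpace ℝ (Fin 3) => φ.normed volume q.1 • gradient annularKernel q.2)) :=
    hκc.contDiff_convolution_right _ (locallyIntegrable_vectorDensity_uncurry hW) hκ
  have e : (fun z : ℝ × EuclideanSpace ℝ (Fin 3) =>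
      (φ.normed volume ⋆[lsmul ℝ ℝ, volume] fun σ => driftField W σ z.2) z.1) =
      ((fun q : ℝ × EuclideanSpace ℝ (Fin 3) => scalarDensity (W q.1) q.2) ⋆[
          (lsmul ℝ ℝ : ℝ →L[ℝ] EuclideanSpace ℝ (Fin 3) →L[ℝ] EuclideanSpace ℝ (Fin 3)), volume]
        (fun q : ℝ × EuclideanSpace ℝ (Fin 3) => φ.normed volume q.1 • gradient annularKernel q.2)) -
      ((fun q : ℝ × EuclideanSpace ℝ (Fin 3) => vectorDensity (W q.1) q.2) ⋆[crossCLM.flip, volume]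
        (fun q : ℝ × EuclideanSpace ℝ (Fin 3) => φ.normed volume q.1 • gradient annularKernel q.2)) := by
    funext z
    rw [Pi.sub_apply]
    exact timeConv_driftField_eq_convolution_sub hW φ z.1 z.2
  rw [e]
  exact h₁.sub h₂

end Kwon2023

end Literature.Analysis.FluidPDE

end
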